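import Literature.Analysis.FluidPDE.NSRegFourierBilinear
import Mathlib.MeasureTheory.Group.Prod
import HarnessLib

/-!
# Antisymmetry of the Fourier-side convective trilinear form

Support file of the Fourier-side construction of the global regular solution of the
Leray-regularised Navier–Stokes system (discharge of
`Literature.Analysis.FluidPDE.leray_regularised_wellposed`). The energy identity of the
(regularised) Navier–Stokes equations rests on the cancellation `∫ ⟪(b·∇)u, u⟫ = 0` for a
divergence-free advecting field `b` (Leray 1934, (1.12)/(3.4): "relation de dissipation de
l'énergie"; for the regularised system `b = J u`, Ożański–Pooley 2018, (6.80)). On the Fourier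
side (`u = 𝓕 g`, `b = 𝓕 f`, products ↦ convolutions `fconv`, `∂ⱼ ↦ -2πi ξⱼ`) the pairing
`∫ ⟪(b·∇)u, w⟫` is, up to the factor `-2πi` and Plancherel, the **trilinear form**

  `P(f, g, h) = ∑_{j,k} ∫ ξⱼ (fⱼ ⋆ g_k)(ξ) conj (h_k(ξ)) dξ`   (`triP`),

and the cancellation is the antisymmetry `P(f, g, h) = -P(f, h, g)`, proved here by the change of
variables `(ξ, η) ↦ (η, ξ - η)` and `ζ ↦ -ζ - η`, using the transversality of the advecting
coefficient field (`∑ⱼ ηⱼ fⱼ(η) = 0`, i.e. `div b = 0`) and the conjugation symmetry of `g`, `h`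
(reality of `u`, `w`). Everything is stated for measurable coefficient fields with
`f ∈ L¹ ∩ L²`, `g, h ∈ L²` with `‖ξ‖ g, ‖ξ‖ h ∈ L²` (i.e. `u, w ∈ H¹`), the integrability under
which all integrals converge absolutely (Fubini).

* `triKernel f g h (η, ζ) = ∑_{j,k} ζⱼ fⱼ(η) g_k(ζ) conj (h_k(ζ + η))`, `triInt = ∫∫ triKernel`;
* `integrable_triKernel` — absolute convergence (Tonelli, Cauchy–Schwarz in `ζ`, translation
  invariance);
* `triInt_swap_eq_neg` — `I(f, h, g) = -I(f, g, h)` (the substitution `ζ ↦ -ζ - η`);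
* `triP_eq_triInt` — `P = I` (transversality of `f` and the shear `(ξ, η) ↦ (η, ξ - η)`);
* `triP_self_eq_zero` — **`P(f, g, g) = 0`**;
* `sum_conj_mul_nonlin` — `∑ₗ conj(Vₗ) N(f, g)ₗ = -2πi ∑_{j,k} ξⱼ (fⱼ ⋆ g_k) conj(V_k)` for a
  transversal `V` (the Leray projector is self-adjoint and fixes transversal vectors), and
  `integral_sum_conj_mul_nonlin_vmul_self` — **the energy cancellation**
  `∫ ∑ₗ conj(V(ξ)ₗ) N(m • V, V)(ξ)ₗ dξ = 0` for the regularised nonlinearity.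

## Mathlib / tree search

`MeasureTheory.measurePreserving_prod_sub_swap` (the shear `(ξ, η) ↦ (η, ξ - η)`),
`measurePreserving_prod_add`, `Measure.measurePreserving_neg`, `MeasurePreserving.prod`,
`integral_map`, `integral_prod` (Fubini), `lintegral_prod` (Tonelli),
`ENNReal.lintegral_mul_le_Lp_mul_Lq`; the tree's `FourierNS.fconv`, `FourierNS.nonlin`,
`FourierNS.lerayDerivSymbol`, `NSRegFourierBilinear`. No Fourier-side trilinear form exists in
Mathlib or the tree (searched `trilinear`, `antisymm` + `convolution`).

## References

* J. Leray, Acta Math. 63 (1934), (1.12), §17 (3.4). [Leray1934]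
* W. S. Ożański, B. C. Pooley, LMS Lecture Note Ser. 452 (2018), Lemma 6.21, (6.80). [OzanskiPooley2018]
* R. Temam, *Navier–Stokes Equations* (1977/1984), Ch. II, Lemma 1.3 (`b(u, v, v) = 0`).
-/

noncomputable section

open MeasureTheory Real Set Filter Topology Function Complex
open scoped ENNReal NNReal ComplexConjugate

namespace Literature.Analysis.FluidPDE.FourierNS

variable {ι : Type*} [Fintype ι]

/-! ### The kernel of the trilinear form and its integrability -/

section Kernel

/-- The kernel `Φ_{f,g,h}(η, ζ) = ∑_{j,k} ζⱼ fⱼ(η) g_k(ζ) conj (h_k(ζ + η))` of the trilinear form in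
the sheared variables `(η, ζ = ξ - η)`. [folklore] -/
def triKernel (f g h : (EuclideanSpace ℝ ι) → ι → ℂ) (p : (EuclideanSpace ℝ ι) × (EuclideanSpace ℝ ι)) : ℂ :=
  ∑ j, ∑ k, (p.2 j : ℂ) * f p.1 j * g p.2 k * conj (h (p.2 + p.1) k)

/-- The trilinear integral `I(f, g, h) = ∫∫ Φ_{f,g,h}`. [folklore] -/
def triInt (f g h : (EuclideanSpace ℝ ι) → ι → ℂ) : ℂ :=
  ∫ p, triKernel f g h p ∂((volume : Measure (EuclideanSpace ℝ ι)).prod volume)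

/-- **The trilinear form** `P(f, g, h) = ∑_{j,k} ∫ ξⱼ (fⱼ ⋆ g_k)(ξ) conj (h_k(ξ)) dξ`
(Fourier side of `∫ ⟪(b·∇)u, w⟫` with `b = 𝓕 f`, `u = 𝓕 g`, `w = 𝓕 h`, up to `-2πi`; Temam 1977,
Ch. II §1, the form `b(u, v, w)`). [folklore] -/
def triP (f g h : (EuclideanSpace ℝ ι) → ι → ℂ) : ℂ :=
  ∑ j, ∑ k, ∫ ξ, (ξ j : ℂ) * fconv (f · j) (g · k) ξ * conj (h ξ k)

variable {f g h : (EuclideanSpace ℝ ι) → ι → ℂ}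

/-- Measurability of the kernel. [folklore] -/
theorem measurable_triKernel (hf : Measurable f) (hg : Measurable g) (hh : Measurable h) :
    Measurable (triKernel f g h) := by
  unfold triKernel
  refine Finset.measurable_sum _ fun j _ => Finset.measurable_sum _ fun k _ => ?_
  have h1 : Measurable fun p : (EuclideanSpace ℝ ι) × (EuclideanSpace ℝ ι) => (p.2 j : ℂ) :=
    Complex.measurable_ofReal.comp ((EuclideanSpace.proj j).continuous.measurable.comp measurable_snd)
  have h2 : Measurable fun p : (EuclideanSpace ℝ ι) × (EuclideanSpace ℝ ι) => f p.1 j :=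
    (measurable_pi_iff.1 hf j).comp measurable_fst
  have h3 : Measurable fun p : (EuclideanSpace ℝ ι) × (EuclideanSpace ℝ ι) => g p.2 k :=
    (measurable_pi_iff.1 hg k).comp measurable_snd
  have h4 : Measurable fun p : (EuclideanSpace ℝ ι) × (EuclideanSpace ℝ ι) => conj (h (p.2 + p.1) k) :=
    Complex.continuous_conj.measurable.comp ((measurable_pi_iff.1 hh k).comp (measurable_snd.add measurable_fst))
  exact ((h1.mul h2).mul h3).mul h4

/-- Pointwise bound of the kernel:
`‖Φ(η, ζ)‖ ≤ card² ‖f η‖ (‖ζ‖ ‖g ζ‖) ‖h(ζ + η)‖`. [folklore] -/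
theorem norm_triKernel_le (p : (EuclideanSpace ℝ ι) × (EuclideanSpace ℝ ι)) :
    ‖triKernel f g h p‖ ≤ (Fintype.card ι : ℝ) ^ 2 * (‖f p.1‖ * (‖p.2‖ * ‖g p.2‖) * ‖h (p.2 + p.1)‖) := by
  unfold triKernel
  refine norm_sum_sum_le fun j k => ?_
  rw [norm_mul, norm_mul, norm_mul, Complex.norm_real, Real.norm_eq_abs, Complex.norm_conj]
  calc |p.2 j| * ‖f p.1 j‖ * ‖g p.2 k‖ * ‖h (p.2 + p.1) k‖
      ≤ ‖p.2‖ * ‖f p.1‖ * ‖g p.2‖ * ‖h (p.2 + p.1)‖ := by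
        gcongr
        · exact abs_apply_le_norm p.2 j
        · exact norm_le_pi_norm _ j
        · exact norm_le_pi_norm _ k
        · exact norm_le_pi_norm _ k
    _ = ‖f p.1‖ * (‖p.2‖ * ‖g p.2‖) * ‖h (p.2 + p.1)‖ := by ring

/-- The inner `ζ`-integral of the dominating function is bounded by Cauchy–Schwarz and
translation invariance: `∫⁻ (‖ζ‖‖g ζ‖) ‖h(ζ + η)‖ dζ ≤ ‖wfun 1 g‖_{L²} ‖h‖_{L²}`. [folklore] -/
theorem lintegral_inner_le (hg : Measurable g) (hh : Measurable h) (η : EuclideanSpace ℝ ι) :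
    ∫⁻ ζ, ENNReal.ofReal (‖ζ‖ * ‖g ζ‖) * ‖h (ζ + η)‖ₑ ≤
      eLpNorm (wfun 1 g) 2 volume * eLpNorm h 2 volume := by
  have ha : Measurable fun ζ : EuclideanSpace ℝ ι => ENNReal.ofReal (‖ζ‖ * ‖g ζ‖) :=
    ENNReal.measurable_ofReal.comp (continuous_norm.measurable.mul hg.norm)
  have hb : Measurable fun ζ : EuclideanSpace ℝ ι => ‖h (ζ + η)‖ₑ := (hh.comp (measurable_add_const η)).enorm
  have hH := ENNReal.lintegral_mul_le_Lp_mul_Lq volume Real.HolderConjugate.two_two ha.aemeasurable hb.aemeasurable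
  simp only [Pi.mul_apply] at hH
  refine hH.trans (mul_le_mul' ?_ (le_of_eq ?_))
  · rw [eLpNorm_eq_lintegral_rpow_enorm_toReal two_ne_zero ENNReal.ofNat_ne_top, ENNReal.toReal_ofNat]
    refine ENNReal.rpow_le_rpow (lintegral_mono fun ζ => ?_) (by norm_num)
    refine ENNReal.rpow_le_rpow ?_ (by norm_num)
    rw [enorm_wfun, pow_one, ← ofReal_norm (g ζ), ← ENNReal.ofReal_mul (by positivity)]
    exact ENNReal.ofReal_le_ofReal (by nlinarith [norm_nonneg ζ, norm_nonneg (g ζ)])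
  · rw [eLpNorm_eq_lintegral_rpow_enorm_toReal two_ne_zero ENNReal.ofNat_ne_top, ENNReal.toReal_ofNat]
    congr 1
    exact lintegral_add_right_eq_self (μ := (volume : Measure (EuclideanSpace ℝ ι))) (fun ζ => ‖h ζ‖ₑ ^ (2 : ℝ)) η

/-- **Absolute convergence of the trilinear integral**: the kernel is integrable on `E × E` when
`f ∈ L¹`, `‖ξ‖ g ∈ L²`, `h ∈ L²` (Tonelli and the inner bound). [folklore] -/
theorem integrable_triKernel (hf : Measurable f) (hg : Measurable g) (hh : Measurable h)
    (hf1 : Integrable f volume) (hg1 : eLpNorm (wfun 1 g) 2 volume < ∞) (hh2 : eLpNorm h 2 volume < ∞) :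
    Integrable (triKernel f g h) ((volume : Measure (EuclideanSpace ℝ ι)).prod volume) := by
  set D : (EuclideanSpace ℝ ι) × (EuclideanSpace ℝ ι) → ℝ≥0∞ := fun p =>
    ‖f p.1‖ₑ * (ENNReal.ofReal (‖p.2‖ * ‖g p.2‖) * ‖h (p.2 + p.1)‖ₑ) with hD
  have hDm : Measurable D := by
    refine ((hf.comp measurable_fst).enorm).mul ((ENNReal.measurable_ofReal.comp ?_).mul ?_)
    · exact (continuous_norm.measurable.comp measurable_snd).mul ((hg.comp measurable_snd).norm)
    · exact (hh.comp (measurable_snd.add measurable_fst)).enorm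
  have hDint : ∫⁻ p, D p ∂((volume : Measure (EuclideanSpace ℝ ι)).prod volume) < ∞ := by
    rw [lintegral_prod _ hDm.aemeasurable]
    calc ∫⁻ η, ∫⁻ ζ, D (η, ζ) = ∫⁻ η, ‖f η‖ₑ * ∫⁻ ζ, ENNReal.ofReal (‖ζ‖ * ‖g ζ‖) * ‖h (ζ + η)‖ₑ := by
          refine lintegral_congr fun η => ?_
          simp only [hD]
          rw [lintegral_const_mul _ (by
            exact (ENNReal.measurable_ofReal.comp (continuous_norm.measurable.mul hg.norm)).mul
              ((hh.comp (measurable_add_const η)).enorm))]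
      _ ≤ ∫⁻ η, ‖f η‖ₑ * (eLpNorm (wfun 1 g) 2 volume * eLpNorm h 2 volume) :=
          lintegral_mono fun η => mul_le_mul_right (lintegral_inner_le hg hh η) _
      _ = (∫⁻ η, ‖f η‖ₑ) * (eLpNorm (wfun 1 g) 2 volume * eLpNorm h 2 volume) := by
          rw [lintegral_mul_const _ hf.enorm]
      _ < ∞ := ENNReal.mul_lt_top hf1.hasFiniteIntegral (ENNReal.mul_lt_top hg1 hh2)
  refine ⟨(measurable_triKernel hf hg hh).aestronglyMeasurable, ?_⟩
  have hle : ∀ p, ‖triKernel f g h p‖ₑ ≤ ENNReal.ofReal ((Fintype.card ι : ℝ) ^ 2) * D p := by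
    intro p
    rw [← ofReal_norm, hD]
    simp only
    rw [← ofReal_norm (f p.1), ← ofReal_norm (h (p.2 + p.1)), ← ENNReal.ofReal_mul (by positivity),
      ← ENNReal.ofReal_mul (by positivity), ← ENNReal.ofReal_mul (by positivity)]
    refine ENNReal.ofReal_le_ofReal ((norm_triKernel_le p).trans (le_of_eq ?_))
    ring
  calc ∫⁻ p, ‖triKernel f g h p‖ₑ ∂((volume : Measure (EuclideanSpace ℝ ι)).prod volume)
      ≤ ∫⁻ p, ENNReal.ofReal ((Fintype.card ι : ℝ) ^ 2) * D p ∂((volume : Measure (EuclideanSpace ℝ ι)).prod volume) :=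
        lintegral_mono hle
    _ = ENNReal.ofReal ((Fintype.card ι : ℝ) ^ 2) * ∫⁻ p, D p ∂((volume : Measure (EuclideanSpace ℝ ι)).prod volume) :=
        lintegral_const_mul _ hDm
    _ < ∞ := ENNReal.mul_lt_top ENNReal.ofReal_lt_top hDint

end Kernel

/-! ### Antisymmetry under the substitution `ζ ↦ -ζ - η` -/

section Antisymmetry

variable {f g h : (EuclideanSpace ℝ ι) → ι → ℂ}

/-- Integral of a function over `E × E` composed with a measure-preserving self-map. [folklore] -/
theorem integral_comp_measurePreserving {F : (EuclideanSpace ℝ ι) × (EuclideanSpace ℝ ι) → ℂ}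
    {S : (EuclideanSpace ℝ ι) × (EuclideanSpace ℝ ι) → (EuclideanSpace ℝ ι) × (EuclideanSpace ℝ ι)}
    (hS : MeasurePreserving S ((volume : Measure (EuclideanSpace ℝ ι)).prod volume) ((volume : Measure (EuclideanSpace ℝ ι)).prod volume))
    (hF : Measurable F) :
    ∫ p, F (S p) ∂((volume : Measure (EuclideanSpace ℝ ι)).prod volume) =
      ∫ p, F p ∂((volume : Measure (EuclideanSpace ℝ ι)).prod volume) := by
  rw [← integral_map hS.measurable.aemeasurable (by rw [hS.map_eq]; exact hF.aestronglyMeasurable), hS.map_eq]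

/-- The substitution `(η, ζ) ↦ (η, -ζ - η)` preserves the product measure. [folklore] -/
theorem measurePreserving_negShear :
    MeasurePreserving (fun p : (EuclideanSpace ℝ ι) × (EuclideanSpace ℝ ι) => (p.1, -p.2 - p.1))
      ((volume : Measure (EuclideanSpace ℝ ι)).prod volume) ((volume : Measure (EuclideanSpace ℝ ι)).prod volume) := by
  have h1 := measurePreserving_prod_add (volume : Measure (EuclideanSpace ℝ ι)) (volume : Measure (EuclideanSpace ℝ ι))
  have h2 : MeasurePreserving (Prod.map (id : EuclideanSpace ℝ ι → EuclideanSpace ℝ ι)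
      (Neg.neg : EuclideanSpace ℝ ι → EuclideanSpace ℝ ι)) ((volume : Measure (EuclideanSpace ℝ ι)).prod volume)
      ((volume : Measure (EuclideanSpace ℝ ι)).prod volume) :=
    (MeasurePreserving.id volume).prod (Measure.measurePreserving_neg volume)
  have heq : (fun p : (EuclideanSpace ℝ ι) × (EuclideanSpace ℝ ι) => (p.1, -p.2 - p.1)) =
      (Prod.map (id : EuclideanSpace ℝ ι → EuclideanSpace ℝ ι) (Neg.neg : EuclideanSpace ℝ ι → EuclideanSpace ℝ ι)) ∘
        fun z : (EuclideanSpace ℝ ι) × (EuclideanSpace ℝ ι) => (z.1, z.1 + z.2) := by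
    funext p; simp only [Function.comp_apply, Prod.map_apply, id_eq]; congr 1; abel
  rw [heq]
  exact h2.comp h1

/-- The shear `(ξ, η) ↦ (η, ξ - η)` preserves the product measure. [folklore] -/
theorem measurePreserving_shear :
    MeasurePreserving (fun p : (EuclideanSpace ℝ ι) × (EuclideanSpace ℝ ι) => (p.2, p.1 - p.2))
      ((volume : Measure (EuclideanSpace ℝ ι)).prod volume) ((volume : Measure (EuclideanSpace ℝ ι)).prod volume) :=
  measurePreserving_prod_sub_swap volume volume

/-- **The pointwise antisymmetry identity**: for a transversal advecting field `f`
(`∑ⱼ ηⱼ fⱼ(η) = 0`) and conjugation-symmetric `g`, `h`,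
`Φ_{f,h,g}(η, -ζ - η) = -Φ_{f,g,h}(η, ζ)`. [folklore] -/
theorem triKernel_negShear (hft : ∀ η, ∑ j, (η j : ℂ) * f η j = 0) (hg : ∀ ζ k, g (-ζ) k = conj (g ζ k))
    (hh : ∀ ζ k, h (-ζ) k = conj (h ζ k)) (η ζ : EuclideanSpace ℝ ι) :
    triKernel f h g (η, -ζ - η) = -triKernel f g h (η, ζ) := by
  unfold triKernel
  simp only
  have e1 : -ζ - η + η = -ζ := by abel
  have e2 : -ζ - η = -(ζ + η) := by abel
  have hcoord : ∀ j, ((-ζ - η) j : ℂ) = -(ζ j : ℂ) - (η j : ℂ) := fun j => by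
    simp only [PiLp.sub_apply, PiLp.neg_apply, Complex.ofReal_sub, Complex.ofReal_neg]
  rw [e1]
  simp_rw [hcoord, e2, hh, hg, Complex.conj_conj]
  -- expand and use transversality of `f`
  have hsplit : ∀ j k, (-(ζ j : ℂ) - (η j : ℂ)) * f η j * conj (h (ζ + η) k) * g ζ k =
      -((ζ j : ℂ) * f η j * g ζ k * conj (h (ζ + η) k)) - (η j : ℂ) * f η j * (g ζ k * conj (h (ζ + η) k)) := by
    intro j k; ring
  simp_rw [hsplit, Finset.sum_sub_distrib, Finset.sum_neg_distrib]
  rw [Finset.sum_comm (f := fun j k => (η j : ℂ) * f η j * (g ζ k * conj (h (ζ + η) k)))]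
  simp_rw [← Finset.sum_mul, hft, zero_mul, Finset.sum_const_zero, sub_zero]

/-- **Antisymmetry of the trilinear integral**: `I(f, h, g) = -I(f, g, h)` under transversality of `f`,
conjugation symmetry of `g`, `h`, and measurability (the substitution `ζ ↦ -ζ - η`). [folklore] -/
theorem triInt_swap_eq_neg (hf : Measurable f) (hg : Measurable g) (hh : Measurable h)
    (hft : ∀ η, ∑ j, (η j : ℂ) * f η j = 0) (hgs : ∀ ζ k, g (-ζ) k = conj (g ζ k))
    (hhs : ∀ ζ k, h (-ζ) k = conj (h ζ k)) : triInt f h g = -triInt f g h := by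
  unfold triInt
  rw [← integral_comp_measurePreserving measurePreserving_negShear (measurable_triKernel hf hh hg), ← integral_neg]
  refine integral_congr_ae (Eventually.of_forall fun p => ?_)
  exact triKernel_negShear hft hgs hhs p.1 p.2

/-- Consequently `I(f, g, g) = 0`. [folklore] -/
theorem triInt_self_eq_zero (hf : Measurable f) (hg : Measurable g) (hft : ∀ η, ∑ j, (η j : ℂ) * f η j = 0)
    (hgs : ∀ ζ k, g (-ζ) k = conj (g ζ k)) : triInt f g g = 0 := by
  have h := triInt_swap_eq_neg hf hg hg hft hgs hgs
  have h2 : (2 : ℂ) * triInt f g g = 0 := by rw [two_mul]; nth_rewrite 1 [h]; ring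
  simpa using h2

end Antisymmetry

/-! ### `P = I`: the shear `(ξ, η) ↦ (η, ξ - η)` and Fubini -/

section Identification

variable {f g h : (EuclideanSpace ℝ ι) → ι → ℂ}

/-- The kernel on the shear: `Φ(η, ξ - η) = ∑_{j,k} ξⱼ fⱼ(η) g_k(ξ - η) conj (h_k(ξ))` for a
transversal `f`. [folklore] -/
theorem triKernel_shear (hft : ∀ η, ∑ j, (η j : ℂ) * f η j = 0) (ξ η : EuclideanSpace ℝ ι) :
    triKernel f g h (η, ξ - η) = ∑ j, ∑ k, (ξ j : ℂ) * f η j * g (ξ - η) k * conj (h ξ k) := by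
  unfold triKernel
  simp only [sub_add_cancel]
  have hcoord : ∀ j, ((ξ - η) j : ℂ) = (ξ j : ℂ) - (η j : ℂ) := fun j => by
    simp only [PiLp.sub_apply, Complex.ofReal_sub]
  simp_rw [hcoord]
  have hsplit : ∀ j k, ((ξ j : ℂ) - (η j : ℂ)) * f η j * g (ξ - η) k * conj (h ξ k) =
      (ξ j : ℂ) * f η j * g (ξ - η) k * conj (h ξ k) - (η j : ℂ) * f η j * (g (ξ - η) k * conj (h ξ k)) := by
    intro j k; ring
  simp_rw [hsplit, Finset.sum_sub_distrib]
  rw [Finset.sum_comm (f := fun j k => (η j : ℂ) * f η j * (g (ξ - η) k * conj (h ξ k)))]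
  simp_rw [← Finset.sum_mul, hft, zero_mul, Finset.sum_const_zero, sub_zero]

/-- `fconv f g ∈ L²` for `f ∈ L¹`, `g ∈ L²` (weight-`0` case of `eLpNorm_wfun_fconv_le`). [folklore] -/
theorem memLp_two_fconv {φ ψ : (EuclideanSpace ℝ ι) → ℂ} (hφ : Measurable φ) (hψ : Measurable ψ)
    (hφ1 : Integrable φ volume) (hψ2 : MemLp ψ 2 volume) : MemLp (fconv φ ψ) 2 volume := by
  refine ⟨(measurable_fconv hφ hψ).aestronglyMeasurable, ?_⟩
  have h := eLpNorm_wfun_fconv_le hφ hψ 0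
  simp only [wfun_zero] at h
  refine lt_of_le_of_lt h (ENNReal.mul_lt_top ?_ hψ2.eLpNorm_lt_top)
  rw [eLpNorm_one_eq_lintegral_enorm]; exact hφ1.hasFiniteIntegral

/-- The summands of `P` are integrable: `ξⱼ (fⱼ ⋆ g_k)(ξ) conj (h_k(ξ)) ∈ L¹(dξ)` for `f ∈ L¹`,
`g ∈ L²`, `‖ξ‖ h ∈ L²` (the convolution is in `L²` by Young, `ξⱼ h_k` is in `L²`). [folklore] -/
theorem integrable_triP_summand (hf : Measurable f) (hg : Measurable g) (hh : Measurable h)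
    (hf1 : Integrable f volume) (hg2 : MemLp g 2 volume) (hh1 : eLpNorm (wfun 1 h) 2 volume < ∞) (j k : ι) :
    Integrable (fun ξ => (ξ j : ℂ) * fconv (f · j) (g · k) ξ * conj (h ξ k)) volume := by
  have hF : MemLp (fconv (f · j) (g · k)) 2 volume :=
    memLp_two_fconv (measurable_pi_iff.1 hf j) (measurable_pi_iff.1 hg k) (hf1.norm.mono'
      (measurable_pi_iff.1 hf j).aestronglyMeasurable (Eventually.of_forall fun ξ => norm_le_pi_norm _ j)
      |> fun hi => hi) (hg2.eval k)
  have hG : MemLp (fun ξ : EuclideanSpace ℝ ι => (ξ j : ℂ) * conj (h ξ k)) 2 volume := by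
    have hm : AEStronglyMeasurable (fun ξ : EuclideanSpace ℝ ι => (ξ j : ℂ) * conj (h ξ k)) volume :=
      ((Complex.measurable_ofReal.comp (EuclideanSpace.proj j).continuous.measurable).mul
        (Complex.continuous_conj.measurable.comp (measurable_pi_iff.1 hh k))).aestronglyMeasurable
    refine ⟨hm, lt_of_le_of_lt (eLpNorm_mono fun ξ => ?_) hh1⟩
    rw [norm_mul, Complex.norm_real, Real.norm_eq_abs, Complex.norm_conj, norm_wfun, pow_one]
    calc |ξ j| * ‖h ξ k‖ ≤ ‖ξ‖ * ‖h ξ‖ := mul_le_mul (abs_apply_le_norm ξ j) (norm_le_pi_norm _ k) (norm_nonneg _) (norm_nonneg _)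
      _ ≤ (1 + ‖ξ‖) * ‖h ξ‖ := by gcongr; linarith [norm_nonneg ξ]
  have := hF.integrable_mul hG
  refine this.congr (Eventually.of_forall fun ξ => ?_)
  simp only [Pi.mul_apply]; ring

/-- **`P(f, g, h) = I(f, g, h)`** (transversality of `f`, the shear `(ξ, η) ↦ (η, ξ - η)` and Fubini). [folklore] -/
theorem triP_eq_triInt (hf : Measurable f) (hg : Measurable g) (hh : Measurable h)
    (hf1 : Integrable f volume) (hf2 : MemLp f 2 volume) (hg2 : MemLp g 2 volume)
    (hg1 : eLpNorm (wfun 1 g) 2 volume < ∞) (hh1 : eLpNorm (wfun 1 h) 2 volume < ∞)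
    (hft : ∀ η, ∑ j, (η j : ℂ) * f η j = 0) : triP f g h = triInt f g h := by
  have hh2 : MemLp h 2 volume := ⟨hh.aestronglyMeasurable, (eLpNorm_le_eLpNorm_wfun 1 h 2).trans_lt hh1⟩
  have hK : Integrable (triKernel f g h) ((volume : Measure (EuclideanSpace ℝ ι)).prod volume) :=
    integrable_triKernel hf hg hh hf1 hg1 hh2.eLpNorm_lt_top
  -- `I = ∫∫ Φ ∘ shear`
  have hKS : Integrable (triKernel f g h ∘ fun p : (EuclideanSpace ℝ ι) × (EuclideanSpace ℝ ι) => (p.2, p.1 - p.2))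
      ((volume : Measure (EuclideanSpace ℝ ι)).prod volume) :=
    (measurePreserving_shear.integrable_comp hK.aestronglyMeasurable).2 hK
  unfold triInt
  rw [← integral_comp_measurePreserving measurePreserving_shear (measurable_triKernel hf hg hh)]
  have hP := integral_prod _ hKS
  simp only [Function.comp_apply] at hP
  rw [hP]
  -- the inner integral
  have hinner : ∀ ξ, ∫ η, triKernel f g h (η, ξ - η) = ∑ j, ∑ k, (ξ j : ℂ) * fconv (f · j) (g · k) ξ * conj (h ξ k) := by
    intro ξ
    simp_rw [triKernel_shear hft ξ]
    have hint : ∀ j k, Integrable (fun η => (ξ j : ℂ) * f η j * g (ξ - η) k * conj (h ξ k)) volume := by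
      intro j k
      have := (integrable_fconv_integrand (hf2.eval j) (hg2.eval k) ξ).const_mul
        (ξ j : ℂ) |>.mul_const (conj (h ξ k))
      refine this.congr (Eventually.of_forall fun η => ?_)
      simp only; ring
    rw [integral_finsetSum _ fun j _ => integrable_finsetSum _ fun k _ => hint j k]
    refine Finset.sum_congr rfl fun j _ => ?_
    rw [integral_finsetSum _ fun k _ => hint j k]
    refine Finset.sum_congr rfl fun k _ => ?_
    rw [fconv_apply, ← integral_const_mul, ← integral_mul_const]
    refine integral_congr_ae (Eventually.of_forall fun η => ?_)
    simp only; ring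
  simp_rw [hinner]
  unfold triP
  rw [integral_finsetSum _ fun j _ => integrable_finsetSum _ fun k _ => integrable_triP_summand hf hg hh hf1 hg2 hh1 j k]
  refine Finset.sum_congr rfl fun j _ => ?_
  rw [integral_finsetSum _ fun k _ => integrable_triP_summand hf hg hh hf1 hg2 hh1 j k]

/-- **`P(f, g, g) = 0`**: the Fourier-side form of `∫ ⟪(b·∇)u, u⟫ = 0` for divergence-free `b`
(Leray 1934, (1.12); Temam 1977, Ch. II, Lemma 1.3). [folklore] -/
theorem triP_self_eq_zero (hf : Measurable f) (hg : Measurable g) (hf1 : Integrable f volume)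
    (hf2 : MemLp f 2 volume) (hg2 : MemLp g 2 volume) (hg1 : eLpNorm (wfun 1 g) 2 volume < ∞)
    (hft : ∀ η, ∑ j, (η j : ℂ) * f η j = 0) (hgs : ∀ ζ k, g (-ζ) k = conj (g ζ k)) : triP f g g = 0 := by
  rw [triP_eq_triInt hf hg hg hf1 hf2 hg2 hg1 hg1 hft]
  exact triInt_self_eq_zero hf hg hft hgs

end Identification

/-! ### The energy cancellation for the projected nonlinearity -/

section Nonlin

variable [DecidableEq ι]
variable {f g V : (EuclideanSpace ℝ ι) → ι → ℂ} {m : (EuclideanSpace ℝ ι) → ℝ}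

/-- **The Leray symbol against a transversal vector**: `∑ₗ m_{jkl}(ξ) cₗ = ξⱼ c_k` whenever
`∑ₗ ξₗ cₗ = 0` (the projector fixes transversal vectors). [folklore] -/
theorem sum_lerayDerivSymbol_mul_of_transversal (j k : ι) (ξ : EuclideanSpace ℝ ι) {c : ι → ℂ}
    (hc : ∑ l, (ξ l : ℂ) * c l = 0) : ∑ l, (lerayDerivSymbol j k l ξ : ℂ) * c l = (ξ j : ℂ) * c k := by
  unfold lerayDerivSymbol
  push_cast
  simp only [apply_ite Complex.ofReal, Complex.ofReal_one, Complex.ofReal_zero]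
  have h1 : ∀ l, (ξ j : ℂ) * ((if k = l then (1 : ℂ) else 0) - (ξ k : ℂ) * (ξ l : ℂ) / ((‖ξ‖ : ℂ) ^ 2)) * c l =
      (ξ j : ℂ) * (if k = l then c l else 0) - (ξ j : ℂ) * (ξ k : ℂ) / ((‖ξ‖ : ℂ) ^ 2) * ((ξ l : ℂ) * c l) := by
    intro l; split_ifs <;> ring
  simp_rw [h1, Finset.sum_sub_distrib, ← Finset.mul_sum, hc, mul_zero, sub_zero, Finset.sum_ite_eq,
    Finset.mem_univ, if_true]

/-- **The nonlinearity against a transversal field**: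
`∑ₗ conj(V(ξ)ₗ) N(f, g)(ξ)ₗ = -2πi ∑_{j,k} ξⱼ (fⱼ ⋆ g_k)(ξ) conj (V(ξ)_k)` when `∑ₗ ξₗ V(ξ)ₗ = 0`. [folklore] -/
theorem sum_conj_mul_nonlin {ξ : EuclideanSpace ℝ ι} (hV : ∑ l, (ξ l : ℂ) * V ξ l = 0) :
    ∑ l, conj (V ξ l) * nonlin f g ξ l =
      -(2 * π * Complex.I) * ∑ j, ∑ k, (ξ j : ℂ) * fconv (f · j) (g · k) ξ * conj (V ξ k) := by
  have hc : ∑ l, (ξ l : ℂ) * conj (V ξ l) = 0 := by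
    have := congrArg conj hV
    simpa [map_sum, map_mul, Complex.conj_ofReal] using this
  simp only [nonlin_apply]
  calc ∑ l, conj (V ξ l) * (-(2 * π * Complex.I) * ∑ j, ∑ k, (lerayDerivSymbol j k l ξ : ℂ) * fconv (f · j) (g · k) ξ)
      = -(2 * π * Complex.I) * ∑ j, ∑ k, fconv (f · j) (g · k) ξ * ∑ l, (lerayDerivSymbol j k l ξ : ℂ) * conj (V ξ l) := by
        rw [Finset.mul_sum]
        simp_rw [Finset.mul_sum]
        rw [Finset.sum_comm]
        refine Finset.sum_congr rfl fun j _ => ?_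
        rw [Finset.sum_comm]
        refine Finset.sum_congr rfl fun k _ => ?_
        refine Finset.sum_congr rfl fun l _ => ?_
        ring
    _ = -(2 * π * Complex.I) * ∑ j, ∑ k, (ξ j : ℂ) * fconv (f · j) (g · k) ξ * conj (V ξ k) := by
        congr 1
        refine Finset.sum_congr rfl fun j _ => Finset.sum_congr rfl fun k _ => ?_
        rw [sum_lerayDerivSymbol_mul_of_transversal j k ξ hc]
        ring

omit [DecidableEq ι] in
/-- `vmul m V` is integrable when `m ∈ L²` and `V ∈ L²` (Cauchy–Schwarz). [folklore] -/
theorem integrable_vmul (hm : Measurable m) (hm2 : eLpNorm (fun ξ => (m ξ : ℂ)) 2 volume < ∞)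
    (hV : Measurable V) (hV2 : MemLp V 2 volume) : Integrable (vmul m V) volume := by
  have hmem : MemLp (fun ξ => |m ξ|) 2 volume := by
    refine ⟨hm.norm.aestronglyMeasurable, ?_⟩
    refine lt_of_le_of_lt (le_of_eq (eLpNorm_congr_norm_ae (Eventually.of_forall fun ξ => ?_))) hm2
    simp
  have hprod : Integrable (fun ξ => |m ξ| * ‖V ξ‖) volume := hmem.integrable_mul hV2.norm
  refine hprod.mono' (measurable_vmul hm hV).aestronglyMeasurable (Eventually.of_forall fun ξ => ?_)
  refine (pi_norm_le_iff_of_nonneg (by positivity)).2 fun j => ?_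
  rw [vmul_apply, norm_mul, Complex.norm_real, Real.norm_eq_abs]
  exact mul_le_mul_of_nonneg_left (norm_le_pi_norm (V ξ) j) (abs_nonneg _)

omit [DecidableEq ι] in
/-- `vmul m V` is transversal when `V` is. [folklore] -/
theorem sum_mul_vmul (hV : ∀ ξ, ∑ l, (ξ l : ℂ) * V ξ l = 0) (η : EuclideanSpace ℝ ι) :
    ∑ j, (η j : ℂ) * vmul m V η j = 0 := by
  simp only [vmul_apply]
  calc ∑ j, (η j : ℂ) * ((m η : ℂ) * V η j) = (m η : ℂ) * ∑ j, (η j : ℂ) * V η j := by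
        rw [Finset.mul_sum]; refine Finset.sum_congr rfl fun j _ => ?_; ring
    _ = 0 := by rw [hV, mul_zero]

/-- **The energy cancellation of the regularised nonlinearity** (Fourier side of
`∫ ⟪((J u)·∇)u, u⟫ = 0`; Leray 1934, (1.12) with §26; Ożański–Pooley 2018, (6.80)): for a measurable
coefficient field `V ∈ L²` with `‖ξ‖ V ∈ L²`, transversal and conjugation symmetric, and a
multiplier `m` (measurable, `|m| ≤ 1`, `m ∈ L²`),
`∫ ∑ₗ conj (V(ξ)ₗ) N(m • V, V)(ξ)ₗ dξ = 0`. [folklore] -/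
theorem integral_sum_conj_mul_nonlin_vmul_self (hm : Measurable m) (hm1 : ∀ ξ, |m ξ| ≤ 1)
    (hm2 : eLpNorm (fun ξ => (m ξ : ℂ)) 2 volume < ∞) (hV : Measurable V) (hV2 : MemLp V 2 volume)
    (hV1 : eLpNorm (wfun 1 V) 2 volume < ∞) (hVt : ∀ ξ, ∑ l, (ξ l : ℂ) * V ξ l = 0)
    (hVs : ∀ ξ l, V (-ξ) l = conj (V ξ l)) :
    ∫ ξ, ∑ l, conj (V ξ l) * nonlin (vmul m V) V ξ l = 0 := by
  have hf : Measurable (vmul m V) := measurable_vmul hm hV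
  have hf1 : Integrable (vmul m V) volume := integrable_vmul hm hm2 hV hV2
  have hf2 : MemLp (vmul m V) 2 volume := memLp_vmul hm hm1 hV2
  have hP : triP (vmul m V) V V = 0 := triP_self_eq_zero hf hV hf1 hf2 hV2 hV1 (sum_mul_vmul hVt) hVs
  simp_rw [sum_conj_mul_nonlin (hVt _)]
  rw [integral_const_mul, integral_finsetSum _ fun j _ => integrable_finsetSum _ fun k _ =>
    integrable_triP_summand hf hV hV hf1 hV2 hV1 j k]
  simp_rw [integral_finsetSum _ fun k _ => integrable_triP_summand hf hV hV hf1 hV2 hV1 _ k]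
  rw [← triP, hP, mul_zero]

end Nonlin

end Literature.Analysis.FluidPDE.FourierNS

end
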